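import Mathlib
import HarnessLib
import Literature.Probability.LatticeModels.IsingThermodynamics
import Literature.MeasureTheory.Moments.HausdorffMomentGeometricDecay

/-!
# Linear transverse gap — the abstract reduction: slab modes and the conditional stub

Helper file (pure theorem file, no definitions) for stub `stub_linearTransverseGap` of line
`self-energy-pick-inversion`, crux `PrecisionLaplacian.DirectCorrelationStableTail`
(item stmt-CriticalPhenomena-4799) of `CriticalPhenomena/Ising3DConformalLimit`.  The measure
theory (moments of a finite measure carried by `[0,1]`: monotone; support `(θ,∞)`-null ⇔ ratio bound
⇔ geometric decay) is the Literature file `Literature/MeasureTheory/Moments/HausdorffMomentGeometricDecay`.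

* §C  For an ARBITRARY `a : ℤ³ → ℝ`, in the expanded vocabulary of the registered stubs
  (`slabMode a i n k = ∑' y : Fin 2 → ℤ, a (Fin.insertNth i n y) * Real.cos (∑ j, k j * y j)`, sup norm
  `‖k‖` on `Fin 2 → ℝ`, reduced zone `∀ j, |k j| ≤ π`): the Hausdorff representation alone gives
  `0 ≤ â⁽ⁱ⁾_{n+1}(k) ≤ â⁽ⁱ⁾_n(k)` for EVERY `k` (so the registered inequality at `k = 0`);
  Hausdorff + exponential decay `â⁽ⁱ⁾_n(k) ≤ C(i,k) e^{-c‖k‖n}` ⇒ the constant-free linear transverse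
  gap with the SAME `c` (and conversely); support `τ⁽ⁱ⁾_k (e^{-c‖k‖}, ∞) = 0` ⇔ gap.
* §D  The registered signature of `stub_linearTransverseGap` with ONE extra hypothesis — the uniform
  exponential decay of the slab modes of `dcf` — proved (`stub_linearTransverseGap_of_slabModeExpDecay`),
  and its `k = 0` case proved unconditionally (`stub_linearTransverseGap_zero_momentum`).

What is NOT here: the decay input itself.  Physically it is the mass gap `m(k) ≥ c‖k‖` of the σ-odd
transfer-matrix sector at transverse momentum `k`, uniformly on the zone; the planner's source is joint
analyticity of `Ĝ = 1/ψ` on a complex cone (nine reflection-positive frames + the Bernstein–Siciak cross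
theorem, Jarnicki–Pflug) + the infrared bound, none of which is in the tree.  Sanity checks: for the
massless Gaussian kernel `G₀ = latticeGreen/2` the direct correlation function is nearest-neighbour, so
`τ_k = a(eᵢ) δ₀` and the gap inequality holds with every `c`; the `G₀`-side gap itself is
`m₀(k) = arccosh(1 + E⊥(k)/2) ≥ (arccosh 3 / π) ‖k‖∞ ≈ 0.561 ‖k‖∞` on `[-π,π]²`, equality at `k = (π,0)`.
-/

noncomputable section

namespace Summit.CriticalPhenomena.Ising3DConformalLimit.Cruxes.DirectCorrelationStableTail.SelfEnergyPickInversion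

open MeasureTheory Filter Topology
open scoped BigOperators
open Literature.Probability.LatticeModels
open Literature.MeasureTheory.Moments

/-! ## §C Slab modes of an arbitrary `a : ℤ³ → ℝ` (expanded vocabulary of the registered stubs)

`slabMode a i n k = ∑' y : Fin 2 → ℤ, a (Fin.insertNth i n y) * Real.cos (∑ j, k j * y j)`;
`IsSlabHausdorff a` and `HasTransverseGap a` are written out exactly as in the registered signatures
(`‖k‖` is the sup norm of `k : Fin 2 → ℝ`). -/

/-- **Hausdorff ⇒ monotone, nonnegative slab modes** (any `a`, any direction `i`, ANY momentum `k`):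
`0 ≤ â⁽ⁱ⁾_{n+1}(k) ≤ â⁽ⁱ⁾_n(k)` for `n ≥ 1`. -/
theorem slabMode_succ_le_of_hausdorff (a : Site 3 → ℝ)
    (hHaus : ∀ (i : Fin 3) (k : Fin 2 → ℝ), ∃ τ : MeasureTheory.Measure ℝ,
      MeasureTheory.IsFiniteMeasure τ ∧ τ (Set.Icc (0 : ℝ) 1)ᶜ = 0 ∧ ∀ n : ℕ, 1 ≤ n →
      (∑' y : Fin 2 → ℤ, a (Fin.insertNth i (n : ℤ) (y) : Site 3) * Real.cos (∑ j, k j * (y j : ℝ))) =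
      ∫ t, t ^ (n - 1) ∂τ)
    (i : Fin 3) (k : Fin 2 → ℝ) (n : ℕ) (hn : 1 ≤ n) :
    (∑' y : Fin 2 → ℤ, a (Fin.insertNth i ((n + 1 : ℕ) : ℤ) (y) : Site 3) *
        Real.cos (∑ j, k j * (y j : ℝ))) ≤
      (∑' y : Fin 2 → ℤ, a (Fin.insertNth i (n : ℤ) (y) : Site 3) * Real.cos (∑ j, k j * (y j : ℝ))) ∧
    0 ≤ (∑' y : Fin 2 → ℤ, a (Fin.insertNth i ((n + 1 : ℕ) : ℤ) (y) : Site 3) *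
        Real.cos (∑ j, k j * (y j : ℝ))) := by
  obtain ⟨τ, hfin, h01, hmom⟩ := hHaus i k
  exact hausdorffSeq_succ_le_and_nonneg (fun n : ℕ => ∑' y : Fin 2 → ℤ,
    a (Fin.insertNth i (n : ℤ) (y) : Site 3) * Real.cos (∑ j, k j * (y j : ℝ))) τ h01 hmom n hn

/-- **The registered inequality at `k = 0`** (warm-up, from the Hausdorff hypothesis ALONE, any
constant `c`): `â⁽ⁱ⁾_{n+1}(0) ≤ e^{-c‖0‖} â⁽ⁱ⁾_n(0) = â⁽ⁱ⁾_n(0)` — the slab sums `S⁽ⁱ⁾(n)` are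
nonincreasing. -/
theorem transverseGap_zero_momentum_of_hausdorff (a : Site 3 → ℝ)
    (hHaus : ∀ (i : Fin 3) (k : Fin 2 → ℝ), ∃ τ : MeasureTheory.Measure ℝ,
      MeasureTheory.IsFiniteMeasure τ ∧ τ (Set.Icc (0 : ℝ) 1)ᶜ = 0 ∧ ∀ n : ℕ, 1 ≤ n →
      (∑' y : Fin 2 → ℤ, a (Fin.insertNth i (n : ℤ) (y) : Site 3) * Real.cos (∑ j, k j * (y j : ℝ))) =
      ∫ t, t ^ (n - 1) ∂τ)
    (c : ℝ) (i : Fin 3) (n : ℕ) (hn : 1 ≤ n) :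
    (∑' y : Fin 2 → ℤ, a (Fin.insertNth i ((n + 1 : ℕ) : ℤ) (y) : Site 3) *
        Real.cos (∑ j, (0 : Fin 2 → ℝ) j * (y j : ℝ))) ≤
      Real.exp (-(c * ‖(0 : Fin 2 → ℝ)‖)) * (∑' y : Fin 2 → ℤ, a (Fin.insertNth i (n : ℤ) (y) : Site 3) *
        Real.cos (∑ j, (0 : Fin 2 → ℝ) j * (y j : ℝ))) := by
  rw [norm_zero, mul_zero, neg_zero, Real.exp_zero, one_mul]
  exact (slabMode_succ_le_of_hausdorff a hHaus i 0 n hn).1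

/-- **Exponential decay ⇒ linear transverse gap** (any `a`, fixed rate constant `c`): under the
Hausdorff representation, `â⁽ⁱ⁾_n(k) ≤ C(i,k) e^{-c‖k‖n}` (`n ≥ 1`, ANY constants `C(i,k)`) on the
reduced zone forces the constant-free gap inequality `â⁽ⁱ⁾_{n+1}(k) ≤ e^{-c‖k‖} â⁽ⁱ⁾_n(k)`. -/
theorem transverseGap_of_hausdorff_of_expDecay (a : Site 3 → ℝ)
    (hHaus : ∀ (i : Fin 3) (k : Fin 2 → ℝ), ∃ τ : MeasureTheory.Measure ℝ,
      MeasureTheory.IsFiniteMeasure τ ∧ τ (Set.Icc (0 : ℝ) 1)ᶜ = 0 ∧ ∀ n : ℕ, 1 ≤ n →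
      (∑' y : Fin 2 → ℤ, a (Fin.insertNth i (n : ℤ) (y) : Site 3) * Real.cos (∑ j, k j * (y j : ℝ))) =
      ∫ t, t ^ (n - 1) ∂τ)
    (c : ℝ)
    (hdecay : ∀ (i : Fin 3) (k : Fin 2 → ℝ), (∀ j, |k j| ≤ Real.pi) → ∃ C : ℝ, ∀ n : ℕ, 1 ≤ n →
      (∑' y : Fin 2 → ℤ, a (Fin.insertNth i (n : ℤ) (y) : Site 3) * Real.cos (∑ j, k j * (y j : ℝ))) ≤
      C * Real.exp (-(c * ‖k‖ * (n : ℝ)))) :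
    ∀ (i : Fin 3) (k : Fin 2 → ℝ), (∀ j, |k j| ≤ Real.pi) → ∀ n : ℕ, 1 ≤ n →
      (∑' y : Fin 2 → ℤ, a (Fin.insertNth i ((n + 1 : ℕ) : ℤ) (y) : Site 3) *
        Real.cos (∑ j, k j * (y j : ℝ))) ≤
      Real.exp (-(c * ‖k‖)) * (∑' y : Fin 2 → ℤ, a (Fin.insertNth i (n : ℤ) (y) : Site 3) *
        Real.cos (∑ j, k j * (y j : ℝ))) := by
  intro i k hk n hn
  obtain ⟨τ, hfin, h01, hmom⟩ := hHaus i k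
  obtain ⟨C, hC⟩ := hdecay i k hk
  refine hausdorffSeq_succ_le_mul_of_le_mul_pow (fun n : ℕ => ∑' y : Fin 2 → ℤ,
    a (Fin.insertNth i (n : ℤ) (y) : Site 3) * Real.cos (∑ j, k j * (y j : ℝ))) τ h01 hmom
    (Real.exp (-(c * ‖k‖))) C (Real.exp_nonneg _) (fun m hm => ?_) n hn
  have hpow : Real.exp (-(c * ‖k‖ * (m : ℝ))) = Real.exp (-(c * ‖k‖)) ^ m := by
    rw [← Real.exp_nat_mul]; ring_nf
  simpa only [hpow] using hC m hm

/-- **Exponential decay in the limsup sense ⇒ linear transverse gap** (any `a`, fixed `c`; the weakest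
form).  Under the Hausdorff representation it suffices that for every reduced `k` and every rate
`c' ∈ (0, c)` the slab modes are EVENTUALLY `≤ C(i,k,c') e^{-c'‖k‖ n}`: the constant-free gap inequality
with the full rate `c` follows (at `k = 0` the hypothesis is never invoked: `(e^{-c‖0‖}, 1) = ∅`). -/
theorem transverseGap_of_hausdorff_of_eventually_expDecay (a : Site 3 → ℝ)
    (hHaus : ∀ (i : Fin 3) (k : Fin 2 → ℝ), ∃ τ : MeasureTheory.Measure ℝ,
      MeasureTheory.IsFiniteMeasure τ ∧ τ (Set.Icc (0 : ℝ) 1)ᶜ = 0 ∧ ∀ n : ℕ, 1 ≤ n →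
      (∑' y : Fin 2 → ℤ, a (Fin.insertNth i (n : ℤ) (y) : Site 3) * Real.cos (∑ j, k j * (y j : ℝ))) =
      ∫ t, t ^ (n - 1) ∂τ)
    (c : ℝ)
    (hdecay : ∀ (i : Fin 3) (k : Fin 2 → ℝ), (∀ j, |k j| ≤ Real.pi) → ∀ c' : ℝ, 0 < c' → c' < c →
      ∃ C : ℝ, ∀ᶠ n : ℕ in Filter.atTop,
      (∑' y : Fin 2 → ℤ, a (Fin.insertNth i (n : ℤ) (y) : Site 3) * Real.cos (∑ j, k j * (y j : ℝ))) ≤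
      C * Real.exp (-(c' * ‖k‖ * (n : ℝ)))) :
    ∀ (i : Fin 3) (k : Fin 2 → ℝ), (∀ j, |k j| ≤ Real.pi) → ∀ n : ℕ, 1 ≤ n →
      (∑' y : Fin 2 → ℤ, a (Fin.insertNth i ((n + 1 : ℕ) : ℤ) (y) : Site 3) *
        Real.cos (∑ j, k j * (y j : ℝ))) ≤
      Real.exp (-(c * ‖k‖)) * (∑' y : Fin 2 → ℤ, a (Fin.insertNth i (n : ℤ) (y) : Site 3) *
        Real.cos (∑ j, k j * (y j : ℝ))) := by
  intro i k hk n hn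
  obtain ⟨τ, hfin, h01, hmom⟩ := hHaus i k
  refine hausdorffSeq_succ_le_mul_of_forall_mem_Ioo_eventually_le (fun n : ℕ => ∑' y : Fin 2 → ℤ,
    a (Fin.insertNth i (n : ℤ) (y) : Site 3) * Real.cos (∑ j, k j * (y j : ℝ))) τ h01 hmom
    (Real.exp (-(c * ‖k‖))) (Real.exp_nonneg _) (fun θ' hθ' hθ'1 => ?_) n hn
  -- `θ' ∈ (e^{-c‖k‖}, 1)` forces `‖k‖ > 0`; write `θ' = e^{-c'‖k‖}` with `c' = -log θ' / ‖k‖ ∈ (0, c)`.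
  have hθ'pos : 0 < θ' := (Real.exp_pos _).trans hθ'
  have hknorm : 0 < ‖k‖ := by
    rcases (norm_nonneg k).lt_or_eq with hlt | heq
    · exact hlt
    · exfalso
      rw [← heq, mul_zero, neg_zero, Real.exp_zero] at hθ'
      exact absurd hθ'1 (not_lt.2 hθ'.le)
  have hlog_neg : Real.log θ' < 0 := Real.log_neg hθ'pos hθ'1
  have hlog_gt : -(c * ‖k‖) < Real.log θ' := by
    have := Real.log_lt_log (Real.exp_pos _) hθ'
    rwa [Real.log_exp] at this
  set c' : ℝ := -Real.log θ' / ‖k‖ with hc'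
  have hc'pos : 0 < c' := div_pos (neg_pos.2 hlog_neg) hknorm
  have hc'lt : c' < c := by
    rw [hc', div_lt_iff₀ hknorm]; linarith
  have hc'k : c' * ‖k‖ = -Real.log θ' := by
    rw [hc', div_mul_cancel₀ _ (ne_of_gt hknorm)]
  obtain ⟨C, hC⟩ := hdecay i k hk c' hc'pos hc'lt
  refine ⟨C, ?_⟩
  filter_upwards [hC] with m hm
  have hpow : Real.exp (-(c' * ‖k‖ * (m : ℝ))) = θ' ^ m := by
    rw [hc'k, neg_mul, neg_neg, mul_comm, Real.exp_nat_mul, Real.exp_log hθ'pos]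
  simpa only [hpow] using hm

/-- **Linear transverse gap ⇒ exponential decay** (elementary converse, any `a`, same `c`, with
`C(i,k) = â⁽ⁱ⁾_1(k) e^{c‖k‖}`). -/
theorem expDecay_of_transverseGap (a : Site 3 → ℝ) (c : ℝ)
    (hgap : ∀ (i : Fin 3) (k : Fin 2 → ℝ), (∀ j, |k j| ≤ Real.pi) → ∀ n : ℕ, 1 ≤ n →
      (∑' y : Fin 2 → ℤ, a (Fin.insertNth i ((n + 1 : ℕ) : ℤ) (y) : Site 3) *
        Real.cos (∑ j, k j * (y j : ℝ))) ≤
      Real.exp (-(c * ‖k‖)) * (∑' y : Fin 2 → ℤ, a (Fin.insertNth i (n : ℤ) (y) : Site 3) *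
        Real.cos (∑ j, k j * (y j : ℝ)))) :
    ∀ (i : Fin 3) (k : Fin 2 → ℝ), (∀ j, |k j| ≤ Real.pi) → ∃ C : ℝ, ∀ n : ℕ, 1 ≤ n →
      (∑' y : Fin 2 → ℤ, a (Fin.insertNth i (n : ℤ) (y) : Site 3) * Real.cos (∑ j, k j * (y j : ℝ))) ≤
      C * Real.exp (-(c * ‖k‖ * (n : ℝ))) := by
  intro i k hk
  refine ⟨(∑' y : Fin 2 → ℤ, a (Fin.insertNth i ((1 : ℕ) : ℤ) (y) : Site 3) *
    Real.cos (∑ j, k j * (y j : ℝ))) * Real.exp (c * ‖k‖), fun n hn => ?_⟩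
  have h := seq_le_mul_pow_of_succ_le_mul (fun n : ℕ => ∑' y : Fin 2 → ℤ,
    a (Fin.insertNth i (n : ℤ) (y) : Site 3) * Real.cos (∑ j, k j * (y j : ℝ))) (Real.exp (-(c * ‖k‖)))
    (Real.exp_nonneg _) (hgap i k hk) n hn
  have hpow : Real.exp (-(c * ‖k‖)) ^ (n - 1) =
      Real.exp (c * ‖k‖) * Real.exp (-(c * ‖k‖ * (n : ℝ))) := by
    rw [← Real.exp_nat_mul, ← Real.exp_add, Nat.cast_sub hn, Nat.cast_one]; ring_nf
  simpa only [hpow, mul_assoc] using h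

/-- **Support ⇒ linear transverse gap** (any `a`, fixed `c`): if the Hausdorff measures `τ⁽ⁱ⁾_k` can
be chosen carried by `[0, e^{-c‖k‖}]` for `k` in the reduced zone, the gap inequality holds. -/
theorem transverseGap_of_hausdorff_support (a : Site 3 → ℝ) (c : ℝ)
    (hsupp : ∀ (i : Fin 3) (k : Fin 2 → ℝ), (∀ j, |k j| ≤ Real.pi) → ∃ τ : MeasureTheory.Measure ℝ,
      MeasureTheory.IsFiniteMeasure τ ∧ τ (Set.Icc (0 : ℝ) 1)ᶜ = 0 ∧
      τ (Set.Ioi (Real.exp (-(c * ‖k‖)))) = 0 ∧ ∀ n : ℕ, 1 ≤ n →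
      (∑' y : Fin 2 → ℤ, a (Fin.insertNth i (n : ℤ) (y) : Site 3) * Real.cos (∑ j, k j * (y j : ℝ))) =
      ∫ t, t ^ (n - 1) ∂τ) :
    ∀ (i : Fin 3) (k : Fin 2 → ℝ), (∀ j, |k j| ≤ Real.pi) → ∀ n : ℕ, 1 ≤ n →
      (∑' y : Fin 2 → ℤ, a (Fin.insertNth i ((n + 1 : ℕ) : ℤ) (y) : Site 3) *
        Real.cos (∑ j, k j * (y j : ℝ))) ≤
      Real.exp (-(c * ‖k‖)) * (∑' y : Fin 2 → ℤ, a (Fin.insertNth i (n : ℤ) (y) : Site 3) *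
        Real.cos (∑ j, k j * (y j : ℝ))) := by
  intro i k hk n hn
  obtain ⟨τ, hfin, h01, hIoi, hmom⟩ := hsupp i k hk
  exact hausdorffSeq_succ_le_mul_of_measure_Ioi_eq_zero (fun n : ℕ => ∑' y : Fin 2 → ℤ,
    a (Fin.insertNth i (n : ℤ) (y) : Site 3) * Real.cos (∑ j, k j * (y j : ℝ))) τ h01 hmom
    (Real.exp (-(c * ‖k‖))) hIoi n hn

/-- **Linear transverse gap ⇒ support** (any `a`, fixed `c`): conversely, under the gap inequality EVERY
Hausdorff representing measure `τ⁽ⁱ⁾_k` (`k` in the reduced zone) is carried by `[0, e^{-c‖k‖}]`. -/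
theorem hausdorff_support_of_transverseGap (a : Site 3 → ℝ) (c : ℝ)
    (hgap : ∀ (i : Fin 3) (k : Fin 2 → ℝ), (∀ j, |k j| ≤ Real.pi) → ∀ n : ℕ, 1 ≤ n →
      (∑' y : Fin 2 → ℤ, a (Fin.insertNth i ((n + 1 : ℕ) : ℤ) (y) : Site 3) *
        Real.cos (∑ j, k j * (y j : ℝ))) ≤
      Real.exp (-(c * ‖k‖)) * (∑' y : Fin 2 → ℤ, a (Fin.insertNth i (n : ℤ) (y) : Site 3) *
        Real.cos (∑ j, k j * (y j : ℝ))))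
    (i : Fin 3) (k : Fin 2 → ℝ) (hk : ∀ j, |k j| ≤ Real.pi) (τ : MeasureTheory.Measure ℝ)
    [MeasureTheory.IsFiniteMeasure τ] (h01 : τ (Set.Icc (0 : ℝ) 1)ᶜ = 0)
    (hmom : ∀ n : ℕ, 1 ≤ n →
      (∑' y : Fin 2 → ℤ, a (Fin.insertNth i (n : ℤ) (y) : Site 3) * Real.cos (∑ j, k j * (y j : ℝ))) =
      ∫ t, t ^ (n - 1) ∂τ) :
    τ (Set.Ioi (Real.exp (-(c * ‖k‖)))) = 0 :=
  measure_Ioi_eq_zero_of_hausdorffSeq_succ_le_mul (fun n : ℕ => ∑' y : Fin 2 → ℤ,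
    a (Fin.insertNth i (n : ℤ) (y) : Site 3) * Real.cos (∑ j, k j * (y j : ℝ))) τ h01 hmom
    (Real.exp (-(c * ‖k‖))) (Real.exp_nonneg _) (hgap i k hk)

/-! ## §D The registered stub, CONDITIONAL on the uniform exponential decay of the slab modes of `dcf`

The one input this line does not produce: `∃ c > 0` such that for every direction `i` and every
reduced transverse momentum `k ∈ [-π,π]²` the slab modes of the critical direct correlation function
decay like `C(i,k) e^{-c‖k‖ n}`.  On the `G`-side this is the statement that the σ-odd transfer-matrix
sector at transverse momentum `k` has mass gap `m(k) ≥ c‖k‖` UNIFORMLY on the zone (for the massless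
Gaussian kernel `G₀ = latticeGreen/2` the direct correlation function is nearest-neighbour, `τ_k = a(e_i)δ₀`
and any `c` works; the `G₀`-side gap is `arccosh(1 + E⊥(k)/2) ≥ (arccosh 3/π)‖k‖∞ ≈ 0.561‖k‖∞`, with
equality at `k = (π,0)`).  With it, the registered implication
`H → Summable dcf → IsSlabHausdorff dcf → HasTransverseGap dcf` follows from §C (`H` and the
summability are not used). -/

/-- **`stub_linearTransverseGap` made conditional.**  The registered signature of
`stub_linearTransverseGap` (hypotheses `H`, `Summable dcf`, `IsSlabHausdorff dcf`, conclusion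
`HasTransverseGap dcf`, all expanded) with ONE extra hypothesis inserted before the conclusion: the
uniform exponential decay `∃ c > 0, ∀ i, ∀ k ∈ [-π,π]², ∃ C, ∀ n ≥ 1, (dcf)^⁽ⁱ⁾_n(k) ≤ C e^{-c‖k‖n}`.
The gap constant produced is the decay rate `c` itself (rigidity of Hausdorff moment sequences,
`transverseGap_of_hausdorff_of_expDecay`). -/
theorem stub_linearTransverseGap_of_slabModeExpDecay :
    (∀ A : Finset (Site 3), (Matrix.of fun (p q : ↥A) => criticalTwoPoint 3 (q.1 - p.1)).PosDef ∧ ∀ u v :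
      ↥A, (u ≠ v → (Matrix.of fun (p q : ↥A) => criticalTwoPoint 3 (q.1 - p.1))⁻¹ u v ≤ 0) ∧ 0 ≤ ∑ w,
      (Matrix.of fun (p q : ↥A) => criticalTwoPoint 3 (q.1 - p.1))⁻¹ u w) →
    Summable (fun x : Site 3 => (⨅ A : {A : Finset (Site 3) // (0 : Site 3) ∈ A ∧ x ∈ A}, -((Matrix.of fun
      (p q : ↥A.1) => criticalTwoPoint 3 (q.1 - p.1))⁻¹ ⟨0, A.2.1⟩ ⟨x, A.2.2⟩))) →
    (∀ (i : Fin 3) (k : Fin 2 → ℝ), ∃ τ : MeasureTheory.Measure ℝ, MeasureTheory.IsFiniteMeasure τ ∧ τ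
      (Set.Icc (0 : ℝ) 1)ᶜ = 0 ∧ ∀ n : ℕ, 1 ≤ n → (∑' y : Fin 2 → ℤ, (⨅ A : {A : Finset (Site 3) // (0 :
      Site 3) ∈ A ∧ (Fin.insertNth i (n : ℤ) (y) : Site 3) ∈ A}, -((Matrix.of fun (p q : ↥A.1) =>
      criticalTwoPoint 3 (q.1 - p.1))⁻¹ ⟨0, A.2.1⟩ ⟨(Fin.insertNth i (n : ℤ) (y) : Site 3), A.2.2⟩)) *
      Real.cos (∑ j, k j * (y j : ℝ))) = ∫ t, t ^ (n - 1) ∂τ) →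
    (∃ c : ℝ, 0 < c ∧ ∀ (i : Fin 3) (k : Fin 2 → ℝ), (∀ j, |k j| ≤ Real.pi) → ∃ C : ℝ, ∀ n : ℕ, 1 ≤ n →
      (∑' y : Fin 2 → ℤ, (⨅ A : {A : Finset (Site 3) // (0 : Site 3) ∈ A ∧ (Fin.insertNth i (n : ℤ) (y) :
      Site 3) ∈ A}, -((Matrix.of fun (p q : ↥A.1) => criticalTwoPoint 3 (q.1 - p.1))⁻¹ ⟨0, A.2.1⟩
      ⟨(Fin.insertNth i (n : ℤ) (y) : Site 3), A.2.2⟩)) * Real.cos (∑ j, k j * (y j : ℝ))) ≤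
      C * Real.exp (-(c * ‖k‖ * (n : ℝ)))) →
    (∃ c : ℝ, 0 < c ∧ ∀ (i : Fin 3) (k : Fin 2 → ℝ), (∀ j, |k j| ≤ Real.pi) → ∀ n : ℕ, 1 ≤ n → (∑' y : Fin
      2 → ℤ, (⨅ A : {A : Finset (Site 3) // (0 : Site 3) ∈ A ∧ (Fin.insertNth i ((n + 1 : ℕ) : ℤ) (y) :
      Site 3) ∈ A}, -((Matrix.of fun (p q : ↥A.1) => criticalTwoPoint 3 (q.1 - p.1))⁻¹ ⟨0, A.2.1⟩
      ⟨(Fin.insertNth i ((n + 1 : ℕ) : ℤ) (y) : Site 3), A.2.2⟩)) * Real.cos (∑ j, k j * (y j : ℝ))) ≤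
      Real.exp (-(c * ‖k‖)) * (∑' y : Fin 2 → ℤ, (⨅ A : {A : Finset (Site 3) // (0 : Site 3) ∈ A ∧
      (Fin.insertNth i (n : ℤ) (y) : Site 3) ∈ A}, -((Matrix.of fun (p q : ↥A.1) => criticalTwoPoint 3 (q.1
      - p.1))⁻¹ ⟨0, A.2.1⟩ ⟨(Fin.insertNth i (n : ℤ) (y) : Site 3), A.2.2⟩)) * Real.cos (∑ j, k j * (y j :
      ℝ)))) := by
  intro _ _ hHaus hdecay
  obtain ⟨c, hc, hdecay⟩ := hdecay
  exact ⟨c, hc, transverseGap_of_hausdorff_of_expDecay (fun x : Site 3 => ⨅ A : {A : Finset (Site 3) //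
    (0 : Site 3) ∈ A ∧ x ∈ A}, -((Matrix.of fun (p q : ↥A.1) => criticalTwoPoint 3 (q.1 - p.1))⁻¹
    ⟨0, A.2.1⟩ ⟨x, A.2.2⟩)) hHaus c hdecay⟩

/-- **`stub_linearTransverseGap` made conditional — weakest (limsup) form.**  The registered signature
with ONE extra hypothesis inserted before the conclusion: `∃ c > 0` such that for every direction `i`,
every reduced `k ∈ [-π,π]²` and every rate `c' ∈ (0, c)`, the slab modes of `dcf` are eventually
`≤ C e^{-c'‖k‖ n}` — i.e. `limsup_n (1/n) log (dcf)^⁽ⁱ⁾_n(k) ≤ -c‖k‖`, the transverse mass gap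
`m(k) ≥ c‖k‖`.  The gap constant produced is `c` itself. -/
theorem stub_linearTransverseGap_of_slabModeEventualExpDecay :
    (∀ A : Finset (Site 3), (Matrix.of fun (p q : ↥A) => criticalTwoPoint 3 (q.1 - p.1)).PosDef ∧ ∀ u v :
      ↥A, (u ≠ v → (Matrix.of fun (p q : ↥A) => criticalTwoPoint 3 (q.1 - p.1))⁻¹ u v ≤ 0) ∧ 0 ≤ ∑ w,
      (Matrix.of fun (p q : ↥A) => criticalTwoPoint 3 (q.1 - p.1))⁻¹ u w) →
    Summable (fun x : Site 3 => (⨅ A : {A : Finset (Site 3) // (0 : Site 3) ∈ A ∧ x ∈ A}, -((Matrix.of fun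
      (p q : ↥A.1) => criticalTwoPoint 3 (q.1 - p.1))⁻¹ ⟨0, A.2.1⟩ ⟨x, A.2.2⟩))) →
    (∀ (i : Fin 3) (k : Fin 2 → ℝ), ∃ τ : MeasureTheory.Measure ℝ, MeasureTheory.IsFiniteMeasure τ ∧ τ
      (Set.Icc (0 : ℝ) 1)ᶜ = 0 ∧ ∀ n : ℕ, 1 ≤ n → (∑' y : Fin 2 → ℤ, (⨅ A : {A : Finset (Site 3) // (0 :
      Site 3) ∈ A ∧ (Fin.insertNth i (n : ℤ) (y) : Site 3) ∈ A}, -((Matrix.of fun (p q : ↥A.1) =>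
      criticalTwoPoint 3 (q.1 - p.1))⁻¹ ⟨0, A.2.1⟩ ⟨(Fin.insertNth i (n : ℤ) (y) : Site 3), A.2.2⟩)) *
      Real.cos (∑ j, k j * (y j : ℝ))) = ∫ t, t ^ (n - 1) ∂τ) →
    (∃ c : ℝ, 0 < c ∧ ∀ (i : Fin 3) (k : Fin 2 → ℝ), (∀ j, |k j| ≤ Real.pi) → ∀ c' : ℝ, 0 < c' → c' < c →
      ∃ C : ℝ, ∀ᶠ n : ℕ in Filter.atTop,
      (∑' y : Fin 2 → ℤ, (⨅ A : {A : Finset (Site 3) // (0 : Site 3) ∈ A ∧ (Fin.insertNth i (n : ℤ) (y) :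
      Site 3) ∈ A}, -((Matrix.of fun (p q : ↥A.1) => criticalTwoPoint 3 (q.1 - p.1))⁻¹ ⟨0, A.2.1⟩
      ⟨(Fin.insertNth i (n : ℤ) (y) : Site 3), A.2.2⟩)) * Real.cos (∑ j, k j * (y j : ℝ))) ≤
      C * Real.exp (-(c' * ‖k‖ * (n : ℝ)))) →
    (∃ c : ℝ, 0 < c ∧ ∀ (i : Fin 3) (k : Fin 2 → ℝ), (∀ j, |k j| ≤ Real.pi) → ∀ n : ℕ, 1 ≤ n → (∑' y : Fin
      2 → ℤ, (⨅ A : {A : Finset (Site 3) // (0 : Site 3) ∈ A ∧ (Fin.insertNth i ((n + 1 : ℕ) : ℤ) (y) :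
      Site 3) ∈ A}, -((Matrix.of fun (p q : ↥A.1) => criticalTwoPoint 3 (q.1 - p.1))⁻¹ ⟨0, A.2.1⟩
      ⟨(Fin.insertNth i ((n + 1 : ℕ) : ℤ) (y) : Site 3), A.2.2⟩)) * Real.cos (∑ j, k j * (y j : ℝ))) ≤
      Real.exp (-(c * ‖k‖)) * (∑' y : Fin 2 → ℤ, (⨅ A : {A : Finset (Site 3) // (0 : Site 3) ∈ A ∧
      (Fin.insertNth i (n : ℤ) (y) : Site 3) ∈ A}, -((Matrix.of fun (p q : ↥A.1) => criticalTwoPoint 3 (q.1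
      - p.1))⁻¹ ⟨0, A.2.1⟩ ⟨(Fin.insertNth i (n : ℤ) (y) : Site 3), A.2.2⟩)) * Real.cos (∑ j, k j * (y j :
      ℝ)))) := by
  intro _ _ hHaus hdecay
  obtain ⟨c, hc, hdecay⟩ := hdecay
  exact ⟨c, hc, transverseGap_of_hausdorff_of_eventually_expDecay (fun x : Site 3 => ⨅ A :
    {A : Finset (Site 3) // (0 : Site 3) ∈ A ∧ x ∈ A}, -((Matrix.of fun (p q : ↥A.1) =>
    criticalTwoPoint 3 (q.1 - p.1))⁻¹ ⟨0, A.2.1⟩ ⟨x, A.2.2⟩)) hHaus c hdecay⟩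

/-- **The registered inequality of `stub_linearTransverseGap` at `k = 0`, unconditionally** (from the
Hausdorff hypothesis alone; `H` and the summability are not used): for every `c`, direction `i` and
`n ≥ 1`, `(dcf)^⁽ⁱ⁾_{n+1}(0) ≤ e^{-c‖0‖} (dcf)^⁽ⁱ⁾_n(0)`, i.e. the slab sums of `dcf` are nonincreasing. -/
theorem stub_linearTransverseGap_zero_momentum :
    (∀ A : Finset (Site 3), (Matrix.of fun (p q : ↥A) => criticalTwoPoint 3 (q.1 - p.1)).PosDef ∧ ∀ u v :
      ↥A, (u ≠ v → (Matrix.of fun (p q : ↥A) => criticalTwoPoint 3 (q.1 - p.1))⁻¹ u v ≤ 0) ∧ 0 ≤ ∑ w,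
      (Matrix.of fun (p q : ↥A) => criticalTwoPoint 3 (q.1 - p.1))⁻¹ u w) →
    Summable (fun x : Site 3 => (⨅ A : {A : Finset (Site 3) // (0 : Site 3) ∈ A ∧ x ∈ A}, -((Matrix.of fun
      (p q : ↥A.1) => criticalTwoPoint 3 (q.1 - p.1))⁻¹ ⟨0, A.2.1⟩ ⟨x, A.2.2⟩))) →
    (∀ (i : Fin 3) (k : Fin 2 → ℝ), ∃ τ : MeasureTheory.Measure ℝ, MeasureTheory.IsFiniteMeasure τ ∧ τ
      (Set.Icc (0 : ℝ) 1)ᶜ = 0 ∧ ∀ n : ℕ, 1 ≤ n → (∑' y : Fin 2 → ℤ, (⨅ A : {A : Finset (Site 3) // (0 :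
      Site 3) ∈ A ∧ (Fin.insertNth i (n : ℤ) (y) : Site 3) ∈ A}, -((Matrix.of fun (p q : ↥A.1) =>
      criticalTwoPoint 3 (q.1 - p.1))⁻¹ ⟨0, A.2.1⟩ ⟨(Fin.insertNth i (n : ℤ) (y) : Site 3), A.2.2⟩)) *
      Real.cos (∑ j, k j * (y j : ℝ))) = ∫ t, t ^ (n - 1) ∂τ) →
    ∀ (c : ℝ) (i : Fin 3) (n : ℕ), 1 ≤ n → (∑' y : Fin 2 → ℤ, (⨅ A : {A : Finset (Site 3) // (0 : Site 3)
      ∈ A ∧ (Fin.insertNth i ((n + 1 : ℕ) : ℤ) (y) : Site 3) ∈ A}, -((Matrix.of fun (p q : ↥A.1) =>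
      criticalTwoPoint 3 (q.1 - p.1))⁻¹ ⟨0, A.2.1⟩ ⟨(Fin.insertNth i ((n + 1 : ℕ) : ℤ) (y) : Site 3),
      A.2.2⟩)) * Real.cos (∑ j, (0 : Fin 2 → ℝ) j * (y j : ℝ))) ≤
      Real.exp (-(c * ‖(0 : Fin 2 → ℝ)‖)) * (∑' y : Fin 2 → ℤ, (⨅ A : {A : Finset (Site 3) // (0 : Site 3)
      ∈ A ∧ (Fin.insertNth i (n : ℤ) (y) : Site 3) ∈ A}, -((Matrix.of fun (p q : ↥A.1) =>
      criticalTwoPoint 3 (q.1 - p.1))⁻¹ ⟨0, A.2.1⟩ ⟨(Fin.insertNth i (n : ℤ) (y) : Site 3), A.2.2⟩)) *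
      Real.cos (∑ j, (0 : Fin 2 → ℝ) j * (y j : ℝ))) := by
  intro _ _ hHaus c i n hn
  exact transverseGap_zero_momentum_of_hausdorff (fun x : Site 3 => ⨅ A : {A : Finset (Site 3) //
    (0 : Site 3) ∈ A ∧ x ∈ A}, -((Matrix.of fun (p q : ↥A.1) => criticalTwoPoint 3 (q.1 - p.1))⁻¹
    ⟨0, A.2.1⟩ ⟨x, A.2.2⟩)) hHaus c i n hn

end Summit.CriticalPhenomena.Ising3DConformalLimit.Cruxes.DirectCorrelationStableTail.SelfEnergyPickInversion

end
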